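import Summits.CriticalPhenomena.PercolationContinuityZ3.Theorems.PercNearOneGluingNoHeavyLowerTailFourCopyHubSoundB
import HarnessLib

/-! — part 3: regrouping, the main bound, from the kernel check to real configurations
# `NoHeavyLowerTail` (stmt-CriticalPhenomena-4575) — FOUR-copy switching certificates, IV: SOUNDNESS of the hub checker —
# the real value of a certificate is bounded by the kernel's row value at the real hub state

Support file (prover prim-ineq-prove-3 gen 8; `--supports stmt-CriticalPhenomena-4575`).  No named facts, no sorries.

For a well-formed bounded certificate `c` (`Cert.ok`), a finite graph, a placement `τ` of the four terminals and a
four-tuple `x` of configurations with types `πX, t₁, t₂, t₃` and real projected hub state `s₃`: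
`Sreal c τ x ≤ candT c πX t₁ t₂ t₃ s₃` (`Sreal_le_candT`).  Steps: (1) every program's value is at most the best value
over the admissible output classes at the real avoidance options (parts I–II); (2) regrouping the programs by
(side copy, block of the side root); (3) the stored tables of part III encode these best values with the offset `OFF`,
sums of packed vectors are read digitwise (part III-a), and the kernel's maximum over the option positions dominates the
digit at the real option.  With `piCheck` (every row entry `≤ B`) this gives `Sreal ≤ B(types)` (`Sreal_le_of_piCheck`).
-/

noncomputable section

namespace Summit.CriticalPhenomena.PercolationContinuityZ3.Theorems

namespace FourCopyHub

open Finset Literature.Probability.Percolation Literature.Probability.Percolation.DecisionTree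
open Literature.Probability.Percolation.Gladkov ThreePointLB GroupThreePointLB FourPointAtoms SwitchRelax
open scoped Classical

section Real

variable {V : Type*} [Fintype V] [DecidableEq V] (τ : Fin 4 → V) {c : Cert} (x : Fin 4 → Finset (Sym2 V))

/-! ### Regrouping and the main bound -/

/-- Sum over `List.finRange 4` written out. [folklore] -/
theorem sum_map_finRange4 (g : Fin 4 → ℤ) : ((List.finRange 4).map g).sum = g 0 + g 1 + g 2 + g 3 := by
  rw [show List.finRange 4 = [0, 1, 2, 3] from by decide]; simp [add_assoc]

/-- One-step programs regrouped: hub programs and the fibres of the two side copies. [this work] -/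
theorem sum_one_regroup (hwf : c.wf = true) (πX : Ty) (f : P1 → ℤ) :
    (c.one.map f).sum = ((c.one.filter fun q => q.T = 3).map f).sum +
      ((List.finRange 4).map fun w => ((onef c πX 1 w).map f).sum).sum +
      ((List.finRange 4).map fun w => ((onef c πX 2 w).map f).sum).sum := by
  have wf1 : ∀ q ∈ c.one, q.T ≠ 0 := by
    simp only [Cert.wf, Bool.and_eq_true, List.all_eq_true, P1.wf, decide_eq_true_iff] at hwf; exact hwf.1
  have z0 : ((c.one.filter fun q => q.T = 0).map f).sum = 0 := sum_filter_eq_zero _ _ _ (fun q hq => wf1 q hq)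
  rw [sum_key4 c.one (fun q => q.T) f, z0]
  have hT : ∀ T : Fin 4, ((c.one.filter fun q => q.T = T).map f).sum =
      ((List.finRange 4).map fun w => ((onef c πX T w).map f).sum).sum := fun T => by
    rw [sum_key4 (c.one.filter fun q => q.T = T) (fun q => rep πX q.u) f, sum_map_finRange4]
    simp only [onef, filter_and]
  rw [hT 1, hT 2]; ring

/-- Two-step programs regrouped: side-first and hub-first fibres of the two side copies. [this work] -/
theorem sum_two_regroup (hwf : c.wf = true) (πX : Ty) (f : P2 → ℤ) :
    (c.two.map f).sum =
      ((List.finRange 4).map fun w => ((sff c πX 1 w).map f).sum + ((hff c πX 1 w).map f).sum).sum +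
      ((List.finRange 4).map fun w => ((sff c πX 2 w).map f).sum + ((hff c πX 2 w).map f).sum).sum := by
  have wf2 : ∀ q ∈ c.two, q.T1 ≠ 0 ∧ q.T2 ≠ 0 ∧ q.T2 ≠ q.T1 ∧ (q.T1 = 3 ∨ q.T2 = 3) := by
    simp only [Cert.wf, Bool.and_eq_true, List.all_eq_true, P2.wf, decide_eq_true_iff] at hwf; exact hwf.2
  rw [sum_filter_split c.two f (fun q => q.T2 = 3)]
  -- side-first part
  have hA : ((c.two.filter fun q => q.T2 = 3).map f).sum =
      ((List.finRange 4).map fun w => ((sff c πX 1 w).map f).sum).sum +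
      ((List.finRange 4).map fun w => ((sff c πX 2 w).map f).sum).sum := by
    have z0 : (((c.two.filter fun q => q.T2 = 3).filter fun q => q.T1 = 0).map f).sum = 0 :=
      sum_filter_eq_zero _ _ _ (fun q hq => (wf2 q (List.mem_of_mem_filter hq)).1)
    have z3 : (((c.two.filter fun q => q.T2 = 3).filter fun q => q.T1 = 3).map f).sum = 0 :=
      sum_filter_eq_zero _ _ _ (fun q hq => by
        have h := List.mem_filter.1 hq; have h3 : q.T2 = 3 := by simpa using h.2
        have := (wf2 q h.1).2.2.1; rw [h3] at this; exact fun h' => this h'.symm)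
    rw [sum_key4 (c.two.filter fun q => q.T2 = 3) (fun q => q.T1) f, z0, z3]
    have hT : ∀ T : Fin 4, (((c.two.filter fun q => q.T2 = 3).filter fun q => q.T1 = T).map f).sum =
        ((List.finRange 4).map fun w => ((sff c πX T w).map f).sum).sum := fun T => by
      rw [sum_key4 ((c.two.filter fun q => q.T2 = 3).filter fun q => q.T1 = T) (fun q => rep πX q.u) f,
        sum_map_finRange4]
      simp only [sff, filter_and]
    rw [hT 1, hT 2]; ring
  -- hub-first part
  have hB : ((c.two.filter fun q => ¬q.T2 = 3).map f).sum =
      ((List.finRange 4).map fun w => ((hff c πX 1 w).map f).sum).sum +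
      ((List.finRange 4).map fun w => ((hff c πX 2 w).map f).sum).sum := by
    have hcongr : (c.two.filter fun q => ¬q.T2 = 3) = c.two.filter fun q => q.T1 = 3 :=
      List.filter_congr fun q hq => by
        have h := wf2 q hq
        by_cases h3 : q.T2 = 3
        · have : q.T1 ≠ 3 := fun h1 => h.2.2.1 (h3.trans h1.symm)
          simp [h3, this]
        · have : q.T1 = 3 := h.2.2.2.resolve_right h3
          simp [h3, this]
    have z0 : (((c.two.filter fun q => q.T1 = 3).filter fun q => q.T2 = 0).map f).sum = 0 :=
      sum_filter_eq_zero _ _ _ (fun q hq => (wf2 q (List.mem_of_mem_filter hq)).2.1)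
    have z3 : (((c.two.filter fun q => q.T1 = 3).filter fun q => q.T2 = 3).map f).sum = 0 :=
      sum_filter_eq_zero _ _ _ (fun q hq => by
        have h := List.mem_filter.1 hq; have h3 : q.T1 = 3 := by simpa using h.2
        have := (wf2 q h.1).2.2.1; rw [h3] at this; exact this)
    rw [hcongr, sum_key4 (c.two.filter fun q => q.T1 = 3) (fun q => q.T2) f, z0, z3]
    have hT : ∀ T : Fin 4, (((c.two.filter fun q => q.T1 = 3).filter fun q => q.T2 = T).map f).sum =
        ((List.finRange 4).map fun w => ((hff c πX T w).map f).sum).sum := fun T => by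
      rw [sum_key4 ((c.two.filter fun q => q.T1 = 3).filter fun q => q.T2 = T) (fun q => rep πX q.v) f,
        sum_map_finRange4]
      simp only [hff, filter_and]
    rw [hT 1, hT 2]; ring
  rw [hA, hB, sum_map_finRange4, sum_map_finRange4, sum_map_finRange4, sum_map_finRange4, sum_map_finRange4,
    sum_map_finRange4]
  ring

/-- The decoded columns have the table shape. [this work] -/
theorem shp_colZ (P : PiTabs) (t3 : Ty) (T w : Fin 4) (s3 : St4) :
    Shp c.ncl2 ((mkFib c P t3 T w).colZ c.ncl2 (allTys.map fun t' => (P.opts t' w).map fun q => q.val) s3) := by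
  refine ⟨by rw [Fib.colZ, List.length_map, length_col], fun r hr => ?_⟩
  rw [Fib.colZ, List.mem_map] at hr
  obtain ⟨col, hcol, rfl⟩ := hr
  rw [List.length_map, length_of_mem_col _ _ _ _ hcol]

/-- The side table of a slice has the table shape. [this work] -/
theorem shp_sideL (P : PiTabs) (t3 : Ty) (T : Fin 4) (s3 : St4) :
    Shp c.ncl2 ((mkSlice c P t3).sideL ((List.finRange 4).map fun w => mkFib c P t3 T w) s3) := by
  have hOP : (mkSlice c P t3).OP = (List.finRange 4).map fun w => allTys.map fun t' => (P.opts t' w).map fun q => q.val := rfl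
  have hn2 : (mkSlice c P t3).n2 = c.ncl2 := rfl
  rw [Slice.sideL, hOP, hn2, zipWith_map_map]
  refine shp_foldr _ _ fun L hL => ?_
  obtain ⟨w, _, rfl⟩ := List.mem_map.1 hL
  exact shp_colZ P t3 T w s3

/-- Reading the side table of a slice: the sum of the decoded fibre columns. [this work] -/
theorem lk_sideL (P : PiTabs) (t3 : Ty) (T : Fin 4) (s3 : St4) {a : ℕ} (ha : a < c.ncl2) (t : Ty) :
    lk (lk ((mkSlice c P t3).sideL ((List.finRange 4).map fun w => mkFib c P t3 T w) s3) a []) t.val 0 =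
      ((List.finRange 4).map fun w =>
        lk (lk ((mkFib c P t3 T w).colZ c.ncl2 (allTys.map fun t' => (P.opts t' w).map fun q => q.val) s3) a []) t.val 0).sum := by
  have hOP : (mkSlice c P t3).OP = (List.finRange 4).map fun w => allTys.map fun t' => (P.opts t' w).map fun q => q.val := rfl
  have hn2 : (mkSlice c P t3).n2 = c.ncl2 := rfl
  rw [Slice.sideL, hOP, hn2, zipWith_map_map]
  have hshp : ∀ L ∈ (List.finRange 4).map (fun w => (mkFib c P t3 T w).colZ c.ncl2
      (allTys.map fun t' => (P.opts t' w).map fun q => q.val) s3), Shp c.ncl2 L := by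
    intro L hL
    obtain ⟨w, _, rfl⟩ := List.mem_map.1 hL
    exact shp_colZ P t3 T w s3
  rw [lk_foldr_zipWith2 _ _ hshp ha t.isLt, List.map_map]
  rfl

/-- Reading a table of a shape with any defaults. [this work] -/
theorem lk_lk_of_shp {m : ℕ} {L : List (List ℤ)} (h : Shp m L) {a : ℕ} (ha : a < m) (t : Ty) (d : List ℤ) (d' : ℤ) :
    lk (lk L a d) t.val d' = lk (lk L a []) t.val 0 := by
  have haL : a < L.length := by rw [h.1]; exact ha
  have e : lk L a d = lk L a [] := by simp only [lk, List.getElem?_eq_getElem haL, Option.getD_some]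
  rw [e]
  exact lk_eq_lk_of_lt (by rw [h.2 _ (lk_mem_of_lt L haL [])]; exact t.isLt) _ _

/-- **MAIN BOUND.**  The real value of a usable certificate is at most the kernel's candidate value at the real types
and the real projected hub state. [this work] -/
theorem Sreal_le_candT (hc : c.ok = true) :
    Sreal τ c x ≤ candT c (ftype τ (x 0)) (ftype τ (x 1)) (ftype τ (x 2)) (ftype τ (x 3)) (st τ x 3) := by
  have hwf : c.wf = true := by simp only [Cert.ok, Bool.and_eq_true] at hc; exact hc.1
  have hb : c.bounded = true := by simp only [Cert.ok, Bool.and_eq_true] at hc; exact hc.2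
  set πX := ftype τ (x 0) with hπX
  set t1 := ftype τ (x 1) with ht1
  set t2 := ftype τ (x 2) with ht2
  set t3 := ftype τ (x 3) with ht3
  set s3 := st τ x 3 with hs3
  have H := hub_le τ x hc
  have a1 : c.cls2 t1 < c.ncl2 := cls2_lt hb t1
  have a2 : c.cls2 t2 < c.ncl2 := cls2_lt hb t2
  set SL := mkSlice c (mkPiTabs c πX) t3 with hSL
  have hF1 : SL.F1 = (List.finRange 4).map fun w => mkFib c (mkPiTabs c πX) t3 1 w := rfl
  have hF2 : SL.F2 = (List.finRange 4).map fun w => mkFib c (mkPiTabs c πX) t3 2 w := rfl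
  have shp1 := shp_sideL (c := c) (mkPiTabs c πX) t3 1 s3
  have shp2 := shp_sideL (c := c) (mkPiTabs c πX) t3 2 s3
  have hr1 : (SL.row s3).1 = SL.hubT s3 := rfl
  have hr21 : (SL.row s3).2.1 = allTys.map fun t => (SL.sideL SL.F1 s3).map fun r => lk r t.val bot := rfl
  have hr22 : (SL.row s3).2.2 = SL.sideL SL.F2 s3 := rfl
  rw [Sreal, candT, rowAt, ← hSL, hr1, hr21, hr22, lk_map_allTys, hF1, hF2,
    lk_map_of_lt _ (fun r : List ℤ => lk r t1.val bot) _ (by rw [shp1.1]; exact a2) bot [],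
    lk_lk_of_shp shp1 a2 t1 [] bot, lk_lk_of_shp shp2 a1 t2 [] bot,
    lk_sideL _ _ _ _ a2, lk_sideL _ _ _ _ a1, sum_map_finRange4, sum_map_finRange4,
    sum_one_regroup hwf πX, sum_two_regroup hwf πX, sum_map_finRange4, sum_map_finRange4, sum_map_finRange4,
    sum_map_finRange4]
  have hOP : ∀ w : Fin 4, lk SL.OP w.val [] =
      allTys.map fun t' => ((mkPiTabs c πX).opts t' w).map fun q => q.val := fun w => by
    simp only [hSL, mkSlice, lk_map_finRange4]
  have o1 : oth 1 = 2 := by decide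
  have o2 : oth 2 = 1 := by decide
  have G := fun T w h => fibre_le τ x hc T w h
  have G10 := G 1 0 (by decide); have G11 := G 1 1 (by decide); have G12 := G 1 2 (by decide); have G13 := G 1 3 (by decide)
  have G20 := G 2 0 (by decide); have G21 := G 2 1 (by decide); have G22 := G 2 2 (by decide); have G23 := G 2 3 (by decide)
  rw [← hSL, hOP, o1] at G10 G11 G12 G13
  rw [← hSL, hOP, o2] at G20 G21 G22 G23
  linarith

/-! ### From the kernel check to the bound at real configurations -/

omit [DecidableEq V] in
/-- What `piCheck` certifies for one listed hub state. [this work] -/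
theorem candT_le_of_piCheck {B : Ty → Ty → Ty → ℤ} {πX : Ty} {chunks : List (Ty × ℕ × ℕ)}
    (h : piCheck c B πX chunks = true) {t3 : Ty} {lo n : ℕ} (hch : (t3, lo, n) ∈ chunks)
    {s3 : St4} (hs : s3 ∈ ((states πX t3).drop lo).take n) (t1 t2 : Ty) :
    candT c πX t1 t2 t3 s3 ≤ B t1 t2 t3 := by
  simp only [piCheck, List.all_eq_true] at h
  have h1 := h (t3, lo, n) hch s3 hs
  simp only [rowOK, List.all_eq_true, decide_eq_true_iff] at h1
  have e1 : (t1, c.cls t1, c.cls2 t1, allTys.map fun t2 => (t2, c.cls t2, c.cls2 t2, B t1 t2 t3)) ∈ mkK c B t3 :=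
    List.mem_map.2 ⟨t1, mem_allTys t1, rfl⟩
  have e2 : (t2, c.cls t2, c.cls2 t2, B t1 t2 t3) ∈ (allTys.map fun t2 => (t2, c.cls t2, c.cls2 t2, B t1 t2 t3)) :=
    List.mem_map.2 ⟨t2, mem_allTys t2, rfl⟩
  exact h1 _ e1 _ e2

omit [DecidableEq V] in
/-- Covered positions are listed in some chunk. [this work] -/
theorem exists_chunk_of_covers {πX : Ty} {chunks : List (Ty × ℕ × ℕ)} (h : covers πX chunks = true) {t3 : Ty} {s3 : St4}
    (hs : s3 ∈ states πX t3) : ∃ lo n, (t3, lo, n) ∈ chunks ∧ s3 ∈ ((states πX t3).drop lo).take n := by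
  simp only [covers, List.all_eq_true, List.any_eq_true, decide_eq_true_iff, List.mem_range] at h
  obtain ⟨i, hi, rfl⟩ := List.getElem_of_mem hs
  obtain ⟨ch, hch, ht, hlo, hin⟩ := h t3 (mem_allTys t3) i hi
  obtain ⟨t, lo, n⟩ := ch
  simp only at ht hlo hin
  subst ht
  refine ⟨lo, n, hch, ?_⟩
  rw [List.mem_take_iff_getElem]
  refine ⟨i - lo, by rw [List.length_drop]; omega, ?_⟩
  rw [List.getElem_drop]
  congr 1; omega

/-- **The bound at real configurations.**  If the kernel check of the source type of `x 0` passes with full coverage,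
the real value is at most `B` at the real types. [this work] -/
theorem Sreal_le_of_piCheck (hc : c.ok = true) {B : Ty → Ty → Ty → ℤ} {chunks : List (Ty × ℕ × ℕ)}
    (h : piCheck c B (ftype τ (x 0)) chunks = true) (hcov : covers (ftype τ (x 0)) chunks = true) :
    Sreal τ c x ≤ B (ftype τ (x 1)) (ftype τ (x 2)) (ftype τ (x 3)) := by
  have hs : st τ x 3 ∈ states (ftype τ (x 0)) (ftype τ (x 3)) := proj_realSt4_mem_states τ (x 0) (x 3)
  obtain ⟨lo, n, hch, hmem⟩ := exists_chunk_of_covers hcov hs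
  exact (Sreal_le_candT τ x hc).trans (candT_le_of_piCheck h hch hmem _ _)

end Real

end FourCopyHub

end Summit.CriticalPhenomena.PercolationContinuityZ3.Theorems

end
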